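import Mathlib
import Literature.Probability.RandomPlanarGeometry.RectangleConformalMap
import Literature.Probability.RandomPlanarGeometry.ModulusPreservingBoundaryMap
import Literature.Probability.RandomPlanarGeometry.JordanArcUniqueness
import Literature.Probability.RandomPlanarGeometry.TranslatedRectangleDomains
import HarnessLib

/-!
# Modulus-preserving homeomorphisms are holomorphic or anti-holomorphic

Topic `Literature/Probability/RandomPlanarGeometry` (the rigidity step of crux
stmt-CriticalPhenomena-0698, `Summits/CriticalPhenomena/CardyFormulaZ2`).

A homeomorphism `T` of the plane preserving the conformal modulus of every conformal rectangle is
holomorphic or anti-holomorphic on every square `(-R, R)²`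
(`holoOrAnti_symRect_of_modulusPreserving`); this is the classical fact that 1-quasiconformal
homeomorphisms in the geometric sense are conformal or anti-conformal (Lehto–Virtanen (1973),
Ch. I §5), in the form needed downstream.

Argument. Let `B = (-R, R)²`, `z₀ = x₀ + i y₀ ∈ B`, `H = (-R, R) × (-R, y₀)` (so `z₀ ∈ ∂H` and
`H` shares its bottom side `S` with `B`), and `G_B : B → T B`, `G_H : H → T H` the
(anti)conformal maps with boundary values `T` of `exists_conformalMap_of_modulusPreserving`.
The composite `k = G_B⁻¹ ∘ G_H : H → B` is holomorphic or anti-holomorphic and tends to `q` at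
every point `q ∈ S`; on the small rectangle `H'' = (-R/2, R/2) × (-R, (y₀ - R)/2)`, whose closure
lies in `H ∪ S`, boundary uniqueness (`JordanDomain.eqOn_zero_of_frontier_arc`) gives `k = id` in
the holomorphic case (then `k = id` on `H` by the identity theorem) and `conj k = z + 2 R i` in
the anti-holomorphic case, which is absurd (`k` maps into `B`, above the line `im z = -R`).
Hence `G_H = G_B` on `H`, and letting `z → z₀` inside `H`: `T z₀ = G_B z₀`.

## References

* O. Lehto, K. I. Virtanen, *Quasiconformal Mappings in the Plane*, Springer (1973), Ch. I §5.
-/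

noncomputable section

open Set Filter Topology Complex Metric
open UpperHalfPlane (upperHalfPlaneSet)
open scoped ComplexConjugate

namespace Literature.Probability.RandomPlanarGeometry

/-! ### Holomorphic-or-antiholomorphic maps compose -/

/-- Composition of two maps each of which is holomorphic or anti-holomorphic is again
holomorphic or anti-holomorphic. [folklore] -/
theorem holoOrAnti_comp {f g : ℂ → ℂ} {U V : Set ℂ}
    (hf : DifferentiableOn ℂ f U ∨ DifferentiableOn ℂ (fun z ↦ conj (f z)) U)
    (hg : DifferentiableOn ℂ g V ∨ DifferentiableOn ℂ (fun w ↦ conj (g w)) V)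
    (hV : IsOpen V) (hm : MapsTo f U V) :
    DifferentiableOn ℂ (fun z ↦ g (f z)) U ∨ DifferentiableOn ℂ (fun z ↦ conj (g (f z))) U := by
  rcases hf with hf | hf <;> rcases hg with hg | hg
  · exact Or.inl (hg.comp hf hm)
  · exact Or.inr (hg.comp hf hm)
  · right
    have hP := differentiableOn_conj_conj hV hg
    have hm' : MapsTo (fun z ↦ conj (f z)) U {v | conj v ∈ V} := fun z hz ↦ by
      change conj (conj (f z)) ∈ V
      rw [Complex.conj_conj]; exact hm hz
    exact (hP.comp hf hm').congr fun z _ ↦ by simp only [Function.comp_apply, Complex.conj_conj]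
  · left
    have hP := differentiableOn_conj_conj hV hg
    have hm' : MapsTo (fun z ↦ conj (f z)) U {v | conj v ∈ V} := fun z hz ↦ by
      change conj (conj (f z)) ∈ V
      rw [Complex.conj_conj]; exact hm hz
    exact (hP.comp hf hm').congr fun z _ ↦ by simp only [Function.comp_apply, Complex.conj_conj]

/-- A holomorphic or anti-holomorphic map is continuous. [folklore] -/
theorem continuousOn_of_holoOrAnti {f : ℂ → ℂ} {U : Set ℂ}
    (hf : DifferentiableOn ℂ f U ∨ DifferentiableOn ℂ (fun z ↦ conj (f z)) U) : ContinuousOn f U := by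
  rcases hf with hf | hf
  · exact hf.continuousOn
  · exact (continuous_conj.comp_continuousOn hf.continuousOn).congr fun z _ ↦ by
      simp only [Function.comp_apply, Complex.conj_conj]

/-! ### The composite `k = G_B⁻¹ ∘ G_H` is the identity -/

/-- **The composite `k = G_B⁻¹ ∘ G_H` is the identity on `H`.** Abstract form of the interior
agreement argument: `H ⊆ B` Jordan domains sharing the boundary piece `S ⊆ {im z = L}` (with the
same parameters, below `t₁`), `B` lying above that line; `H''` a Jordan domain with
`closure H'' ⊆ H ∪ S` whose boundary meets the open set `V` inside `S`; `GiB` (resp. `GH`)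
holomorphic or anti-holomorphic on `T B` (resp. `H`) with boundary limits `B.boundary t` at
`T (B.boundary t)` (resp. `T (H.boundary t)` at `H.boundary t`) for `t ∈ [0, t₁)`. Then
`GiB ∘ GH = id` on `H`. [folklore] -/
theorem comp_eq_id_of_boundary {T : ℂ ≃ₜ ℂ} {B H H'' : JordanDomain} {S V : Set ℂ} {L t₁ : ℝ}
    {GiB GH : ℂ → ℂ}
    (hHB : H.carrier ⊆ B.carrier) (hSH : Disjoint S H.carrier)
    (hS : ∀ q ∈ S, ∃ t ∈ Ico 0 t₁, B.boundary t = q ∧ H.boundary t = q)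
    (hH''H : H''.carrier ⊆ H.carrier) (hcl : closure H''.carrier ⊆ H.carrier ∪ S) (hV : IsOpen V)
    (hfV : frontier H''.carrier ∩ V ⊆ S) (hne : (frontier H''.carrier ∩ V).Nonempty)
    (hSL : ∀ q ∈ S, q.im = L) (hBL : ∀ z ∈ B.carrier, L < z.im)
    (hdiB : DifferentiableOn ℂ GiB (T '' B.carrier) ∨
      DifferentiableOn ℂ (fun w ↦ conj (GiB w)) (T '' B.carrier))
    (hmiB : MapsTo GiB (T '' B.carrier) B.carrier)
    (hliB : ∀ t ∈ Ico 0 t₁, Tendsto GiB (𝓝[T '' B.carrier] (T (B.boundary t))) (𝓝 (B.boundary t)))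
    (hdH : DifferentiableOn ℂ GH H.carrier ∨ DifferentiableOn ℂ (fun z ↦ conj (GH z)) H.carrier)
    (hmH : MapsTo GH H.carrier (T '' H.carrier))
    (hlH : ∀ t ∈ Ico 0 t₁, Tendsto GH (𝓝[H.carrier] (H.boundary t)) (𝓝 (T (H.boundary t)))) :
    EqOn (fun z ↦ GiB (GH z)) id H.carrier := by
  classical
  set k : ℂ → ℂ := fun z ↦ GiB (GH z) with hk
  have hTB : IsOpen (T '' B.carrier) := T.isOpenMap _ B.isOpen
  have hmH' : MapsTo GH H.carrier (T '' B.carrier) := fun z hz ↦ image_mono hHB (hmH hz)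
  have hkm : MapsTo k H.carrier B.carrier := fun z hz ↦ hmiB (hmH' hz)
  have hkd : DifferentiableOn ℂ k H.carrier ∨ DifferentiableOn ℂ (fun z ↦ conj (k z)) H.carrier :=
    holoOrAnti_comp hdH hdiB hTB hmH'
  have hkc : ContinuousOn k H.carrier := continuousOn_of_holoOrAnti hkd
  -- boundary limits of `k` on `S`
  have hklim : ∀ q ∈ S, Tendsto k (𝓝[H.carrier] q) (𝓝 q) := by
    intro q hq
    obtain ⟨t, ht, hBq, hHq⟩ := hS q hq
    have h1 : Tendsto GH (𝓝[H.carrier] q) (𝓝[T '' B.carrier] (T q)) := by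
      refine tendsto_nhdsWithin_iff.2 ⟨?_, eventually_nhdsWithin_of_forall fun z hz ↦ hmH' hz⟩
      have := hlH t ht
      rwa [hHq] at this
    have h2 : Tendsto GiB (𝓝[T '' B.carrier] (T q)) (𝓝 q) := by
      have := hliB t ht
      rwa [hBq] at this
    exact h2.comp h1
  -- the glued map `k̃`
  set kt : ℂ → ℂ := H.carrier.piecewise k id with hkt
  have hktc : ContinuousOn kt (H.carrier ∪ S) :=
    continuousOn_piecewise_of_tendsto H.isOpen hkc hSH hklim
  have hktH : ∀ z ∈ H.carrier, kt z = k z := fun z hz ↦ piecewise_eq_of_mem _ _ _ hz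
  have hktS : ∀ q ∈ S, kt q = q := fun q hq ↦
    piecewise_eq_of_notMem _ _ _ fun h ↦ hSH.le_bot ⟨hq, h⟩
  rcases hkd with hkd | hkd
  · -- holomorphic case: `k̃ - id` vanishes on `∂H'' ∩ V`, hence on `H''`, hence `k = id` on `H`
    set F : ℂ → ℂ := fun z ↦ kt z - z with hF
    have hFd : DifferentiableOn ℂ F H''.carrier :=
      ((hkd.mono hH''H).congr fun z hz ↦ hktH z (hH''H hz)).sub differentiableOn_id
    have hFc : ContinuousOn F (closure H''.carrier) := (hktc.mono hcl).sub continuousOn_id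
    have hF0 : ∀ z ∈ frontier H''.carrier ∩ V, F z = 0 := fun z hz ↦ by
      simp only [hF, hktS z (hfV hz), sub_self]
    have key := H''.eqOn_zero_of_frontier_arc hFd hFc hV hne hF0
    have hkid : EqOn k id H''.carrier := fun z hz ↦ by
      have := key hz
      simp only [hF, Pi.zero_apply, sub_eq_zero, hktH z (hH''H hz)] at this
      exact this
    exact eqOn_id_of_eqOn_open H.isOpen H.isConnected hkd H''.isOpen hH''H H''.nonempty hkid
  · -- anti-holomorphic case: `conj k̃ = z - 2 L i` on `H''`, contradicting `k (H) ⊆ B`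
    exfalso
    set F : ℂ → ℂ := fun z ↦ conj (kt z) - (z - 2 * L * I) with hF
    have hFd : DifferentiableOn ℂ F H''.carrier :=
      ((hkd.mono hH''H).congr fun z hz ↦ by simp only [hktH z (hH''H hz)]).sub
        (differentiableOn_id.sub (differentiableOn_const _))
    have hFc : ContinuousOn F (closure H''.carrier) :=
      (continuous_conj.comp_continuousOn (hktc.mono hcl)).sub
        (continuousOn_id.sub continuousOn_const)
    have hF0 : ∀ z ∈ frontier H''.carrier ∩ V, F z = 0 := fun z hz ↦ by
      have hzS := hfV hz
      simp only [hF, hktS z hzS, sub_eq_zero]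
      apply Complex.ext
      · simp
      · simp [hSL z hzS]
        ring
    have key := H''.eqOn_zero_of_frontier_arc hFd hFc hV hne hF0
    obtain ⟨z₁, hz₁⟩ := H''.nonempty
    have h1 := key hz₁
    simp only [hF, Pi.zero_apply, sub_eq_zero, hktH z₁ (hH''H hz₁)] at h1
    have h2 := congrArg Complex.im h1
    simp only [conj_im, sub_im, mul_im, re_ofNat, ofReal_re, im_ofNat, ofReal_im, mul_zero,
      zero_mul, add_zero, I_im, mul_one, I_re, mul_re, sub_zero] at h2
    have h3 : L < (k z₁).im := hBL _ (hkm (hH''H hz₁))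
    have h4 : L < z₁.im := hBL _ (hHB (hH''H hz₁))
    linarith

/-- **Interior agreement at a boundary point of `H`.** With `k = GiB ∘ GH = id` on `H` and
`GB ∘ GiB = id`, the maps `GH` and `GB` agree on `H`; if `GH → T z₀` at a point `z₀ ∈ ∂H ∩ B`,
continuity of `GB` at `z₀` gives `T z₀ = GB z₀`. [folklore] -/
theorem apply_eq_of_boundary {T : ℂ ≃ₜ ℂ} {B H : JordanDomain} {GB GiB GH : ℂ → ℂ}
    (hHB : H.carrier ⊆ B.carrier) (hk : EqOn (fun z ↦ GiB (GH z)) id H.carrier)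
    (hiB' : ∀ w ∈ T '' B.carrier, GB (GiB w) = w) (hmH : MapsTo GH H.carrier (T '' H.carrier))
    (hGBc : ContinuousOn GB B.carrier) {z₀ : ℂ} (hz₀B : z₀ ∈ B.carrier)
    (hz₀f : z₀ ∈ frontier H.carrier) (hlim : Tendsto GH (𝓝[H.carrier] z₀) (𝓝 (T z₀))) :
    T z₀ = GB z₀ := by
  have heq : EqOn GH GB H.carrier := fun z hz ↦ by
    have h1 : GB (GiB (GH z)) = GH z := hiB' _ (image_mono hHB (hmH hz))
    have h2 : GiB (GH z) = z := hk hz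
    rw [← h1, h2]
  haveI : NeBot (𝓝[H.carrier] z₀) :=
    mem_closure_iff_nhdsWithin_neBot.1 (frontier_subset_closure hz₀f)
  have h1 : Tendsto GB (𝓝[H.carrier] z₀) (𝓝 (T z₀)) :=
    hlim.congr' (eventually_nhdsWithin_of_forall heq)
  have h2 : Tendsto GB (𝓝[H.carrier] z₀) (𝓝 (GB z₀)) :=
    (hGBc.continuousAt (B.isOpen.mem_nhds hz₀B)).tendsto.mono_left nhdsWithin_le_nhds
  exact tendsto_nhds_unique h1 h2

/-! ### The square -/

/-- The square `(-R, R)²` is the carrier of the (trivially translated) rectangle domain. [folklore] -/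
theorem carrier_transRect_zero {R : ℝ} (hR : 0 < R) :
    ((rectDomain R R hR hR).map (similarity 1 one_ne_zero (((0 : ℝ) : ℂ) * I))).carrier =
      symRect R R := by
  ext w
  rw [mem_carrier_transRect hR hR 0, mem_symRect, zero_sub, zero_add]

/-- **(R2') Modulus-preserving homeomorphisms are holomorphic or anti-holomorphic on every
square.** If the homeomorphism `T` of the plane preserves Cardy's cross-ratio of every conformal
rectangle, then on every square `(-R, R)²` either `T` or `conj ∘ T` is holomorphic: `T` agrees
on the square `B` with the (anti)conformal map `G_B` of step (R2), by the sub-rectangle argument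
`comp_eq_id_of_boundary` / `apply_eq_of_boundary` at every point `z₀ ∈ B`. [cite: LehtoVirtanen1973, Ch. I §5] -/
theorem holoOrAnti_symRect_of_modulusPreserving (T : ℂ ≃ₜ ℂ)
    (hT : ∀ (R : ConformalRectangle) (φ : ConformalEquiv upperHalfPlaneSet R.carrier)
      (x : Fin 4 → ℝ) (φ' : ConformalEquiv upperHalfPlaneSet (R.map T).carrier) (x' : Fin 4 → ℝ),
      (∀ i, φ.HasBoundaryValue (x i) (R.pt i)) →
      (∀ i, φ'.HasBoundaryValue (x' i) ((R.map T).pt i)) → crossRatio x = crossRatio x')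
    {R : ℝ} (hR : 0 < R) :
    DifferentiableOn ℂ T (symRect R R) ∨ DifferentiableOn ℂ (fun z ↦ conj (T z)) (symRect R R) := by
  set B : JordanDomain := (rectDomain R R hR hR).map (similarity 1 one_ne_zero (((0 : ℝ) : ℂ) * I))
    with hB
  have h78 : (7 / 8 : ℝ) ∈ Ioo (0 : ℝ) 1 := ⟨by norm_num, by norm_num⟩
  obtain ⟨GB, GiB, hdB, hdiB, -, hmiB, -, hiB', -, hliB⟩ :=
    exists_conformalMap_of_modulusPreserving T hT B h78
  have hBL : ∀ z ∈ B.carrier, -R < z.im := fun z hz ↦ by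
    have := ((mem_carrier_transRect hR hR 0).1 hz).2.1
    linarith
  have claim : ∀ z₀ ∈ B.carrier, T z₀ = GB z₀ := by
    intro z₀ hz₀
    obtain ⟨⟨hx1, hx2⟩, hy1, hy2⟩ := (mem_carrier_transRect hR hR 0).1 hz₀
    rw [zero_sub] at hy1
    rw [zero_add] at hy2
    -- the sub-rectangle `H = (-R, R) × (-R, y₀)` and the small rectangle `H''` on the bottom side
    have hb' : 0 < (z₀.im + R) / 2 := by linarith
    have hb'' : 0 < (z₀.im + R) / 4 := by linarith
    have hR2 : 0 < R / 2 := by linarith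
    set H : JordanDomain := (rectDomain R ((z₀.im + R) / 2) hR hb').map
      (similarity 1 one_ne_zero ((((z₀.im - R) / 2 : ℝ) : ℂ) * I)) with hH
    set H'' : JordanDomain := (rectDomain (R / 2) ((z₀.im + R) / 4) hR2 hb'').map
      (similarity 1 one_ne_zero ((((z₀.im - 3 * R) / 4 : ℝ) : ℂ) * I)) with hH''
    set S : Set ℂ := {q | (-R < q.re ∧ q.re < R) ∧ q.im = -R} with hS
    set V : Set ℂ := {z | (-(R / 2) < z.re ∧ z.re < R / 2) ∧ z.im < (z₀.im - 3 * R) / 4} with hV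
    obtain ⟨GH, GiH, hdH, -, hmH, -, -, -, hlH, -⟩ :=
      exists_conformalMap_of_modulusPreserving T hT H h78
    -- geometry
    have hHB : H.carrier ⊆ B.carrier := fun w hw ↦ by
      obtain ⟨⟨h1, h2⟩, h3, h4⟩ := (mem_carrier_transRect hR hb' _).1 hw
      exact (mem_carrier_transRect hR hR 0).2 ⟨⟨h1, h2⟩, by linarith, by linarith⟩
    have hSH : Disjoint S H.carrier := Set.disjoint_left.2 fun q hqS hqH ↦ by
      have h3 := ((mem_carrier_transRect hR hb' _).1 hqH).2.1
      have := hqS.2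
      linarith
    have hSpar : ∀ q ∈ S, ∃ t ∈ Ico (0 : ℝ) (7 / 8), B.boundary t = q ∧ H.boundary t = q := by
      rintro q ⟨⟨h1, h2⟩, h3⟩
      set θ : ℝ := (q.re + R) / (2 * R) with hθ
      have hθ0 : 0 ≤ θ := div_nonneg (by linarith) (by linarith)
      have hθ1 : θ ≤ 1 := by rw [hθ, div_le_one (by linarith)]; linarith
      have hre : -R + 2 * R * θ = q.re := by rw [hθ]; field_simp; ring
      refine ⟨θ / 4, ⟨by linarith, by linarith⟩, ?_, ?_⟩
      · rw [hB, transRect_boundary_bottom hR hR 0 ⟨hθ0, hθ1⟩, hre]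
        apply Complex.ext <;> simp [h3]
      · rw [hH, transRect_boundary_bottom hR hb' _ ⟨hθ0, hθ1⟩, hre]
        apply Complex.ext
        · simp
        · simp [h3]; ring
    have hH''H : H''.carrier ⊆ H.carrier := fun w hw ↦ by
      obtain ⟨⟨h1, h2⟩, h3, h4⟩ := (mem_carrier_transRect hR2 hb'' _).1 hw
      exact (mem_carrier_transRect hR hb' _).2 ⟨⟨by linarith, by linarith⟩, by linarith, by linarith⟩
    have hcl : closure H''.carrier ⊆ H.carrier ∪ S := fun w hw ↦ by
      obtain ⟨⟨h1, h2⟩, h3, h4⟩ := (mem_closure_transRect hR2 hb'' _).1 hw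
      by_cases him : w.im = -R
      · exact Or.inr ⟨⟨by linarith, by linarith⟩, him⟩
      · refine Or.inl ((mem_carrier_transRect hR hb' _).2 ⟨⟨by linarith, by linarith⟩, ?_, by linarith⟩)
        have : -R ≤ w.im := by linarith
        have : -R < w.im := lt_of_le_of_ne this (Ne.symm him)
        linarith
    have hVo : IsOpen V :=
      ((isOpen_lt continuous_const continuous_re).and (isOpen_lt continuous_re continuous_const)).and
        (isOpen_lt continuous_im continuous_const)
    have hfV : frontier H''.carrier ∩ V ⊆ S := by
      rintro w ⟨hwf, ⟨hv1, hv2⟩, hv3⟩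
      rcases (mem_frontier_transRect hR2 hb'' _).1 hwf with ⟨⟨h1, h2⟩, h3 | h3⟩ | ⟨h1 | h1, h2, h3⟩
      · exact ⟨⟨by linarith, by linarith⟩, by rw [h3]; ring⟩
      · exfalso; rw [h3] at hv3; linarith
      · exfalso; linarith
      · exfalso; linarith
    have hne : (frontier H''.carrier ∩ V).Nonempty := by
      refine ⟨⟨0, -R⟩, ?_, ⟨by simp; linarith, by simp; linarith⟩, by simp; linarith⟩
      rw [mem_frontier_transRect hR2 hb'' _]
      exact Or.inl ⟨⟨by simp; linarith, by simp; linarith⟩, Or.inl (by simp; ring)⟩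
    have hSL : ∀ q ∈ S, q.im = -R := fun q hq ↦ hq.2
    -- `k = GiB ∘ GH = id` on `H`
    have hk := comp_eq_id_of_boundary (T := T) hHB hSH hSpar hH''H hcl hVo hfV hne hSL hBL hdiB hmiB
      hliB hdH hmH hlH
    -- `z₀` is a boundary point of `H` with parameter `(2 + θ) / 4`
    have hz₀f : z₀ ∈ frontier H.carrier := by
      rw [mem_frontier_transRect hR hb' _]
      exact Or.inl ⟨⟨hx1.le, hx2.le⟩, Or.inr (by ring)⟩
    have hlim : Tendsto GH (𝓝[H.carrier] z₀) (𝓝 (T z₀)) := by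
      set θ : ℝ := (R - z₀.re) / (2 * R) with hθ
      have hθ0 : 0 ≤ θ := div_nonneg (by linarith) (by linarith)
      have hθ1 : θ ≤ 1 := by rw [hθ, div_le_one (by linarith)]; linarith
      have hre : R - 2 * R * θ = z₀.re := by rw [hθ]; field_simp; ring
      have ht : (2 + θ) / 4 ∈ Ico (0 : ℝ) (7 / 8) := ⟨by linarith, by linarith⟩
      have hbz : H.boundary ((2 + θ) / 4) = z₀ := by
        rw [hH, transRect_boundary_top hR hb' _ ⟨hθ0, hθ1⟩, hre]
        apply Complex.ext
        · simp
        · simp; ring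
      have := hlH _ ht
      rwa [hbz] at this
    exact apply_eq_of_boundary hHB hk hiB' hmH (continuousOn_of_holoOrAnti hdB) hz₀ hz₀f hlim
  rw [← carrier_transRect_zero hR]
  rcases hdB with hdB | hdB
  · exact Or.inl (hdB.congr fun z hz ↦ claim z hz)
  · exact Or.inr (hdB.congr fun z hz ↦ by rw [claim z hz])

end Literature.Probability.RandomPlanarGeometry
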